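import Literature.Probability.Percolation.DecisionTreeBK
import Summits.CriticalPhenomena.PercolationContinuityZ3.Theorems.PercNearOneGluingNoHeavyQuantProductRowClassCount
import HarnessLib

/-!
# The decision-tree criterion for the per-class count `TN ≤ m·E` ("one good tree per minor suffices")

builds on p205010 (kernel theorem, internal audit signed; external expert review pending)

Support file (`--supports stmt-CriticalPhenomena-4575`), seat `prim-quant-p1` (gen 44); memo
`run/shared/lean/prim/quant/prim-quant-p1-g44/FOR-LEAD-Z32-TREEGAME.md`.  No definitions, no named facts, no sorries;
standard axioms.

The three-port case of `Z(3,2)` is the per-class count "TN ≤ 3·E" (✓ p583525 `ThreeClusterSwap.productRow_of_classCount`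
with `m = 3` feeds ✓ p560550).  p1 g39–g43 attacked it with explicit injections whose decodability had to be proved map
by map.  Gladkov's Lemma 3.1 [Gladkov2024] gives decodability FOR FREE for every *self-determined* set map `Fm`
(`DecisionTree.SelfDetermined`: the set revealed by an adaptive edge-revealing algorithm = decision tree reading the
configuration): in the counting world (second configuration = complement) the swap along `Fm` is the map
`X ↦ X →_{Fm X} (D ∖ X)` ("keep `X` on the revealed set, complement it elsewhere"), and it is an INVOLUTION of the cube
`𝒫(D)`.  Consequently:

* `TreeCount.splice_compl_involutive`, `TreeCount.injOn_treeSwap`, `TreeCount.injOn_treeSwap'` — the swap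
  `X ↦ X →_F (D∖X)` and its complement `X ↦ (D∖X) →_F X` are injective on `𝒫(D)` for every self-determined `Fm`;
* `TreeCount.card_wins_le`, `TreeCount.card_wins'_le` — for ANY predicates `TN`, `W` on configurations, the number of
  `X ∈ TN` whose swap (resp. complemented swap) lies in `W` is at most `#W`;
* `TreeCount.card_le_mul_of_tree`, `…_of_tree'`, `TreeCount.card_le_mul_of_trees` — **the criterion**: if ONE
  self-determined map (one decision tree and one "side"), or a finite family of them counted with multiplicity, wins on
  at least a `1/m` fraction of `TN` (`#TN ≤ m · #wins`), then `#TN ≤ m · #W`;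
* `ThreeClusterSwap.productRow_of_treeWins` — plugged into ✓ p583525: if in every class `I ⊆ U` some self-determined
  map on the free edges wins (hybrid in `ab|c ∪ ac|b`) on at least a third of the class's TN-configurations — for either
  side — then `P(abc)·P(a|b|c) ≤ 3·(P(ab|c)+P(ac|b))` on every finite weighted graph (the hypothesis of p560550).

Numerically (memo §2–§3, exact game values by an adversary/decision-tree minimax computation) the best single tree wins
on at least `2/3` of TN on every graph tested, i.e. this criterion is consistent with the SHARP conjecture `2·TN ≤ 3·E`;
the tree to use is graph-dependent and adaptive (memo §4).
-/

namespace Summit.CriticalPhenomena.PercolationContinuityZ3.Theorems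

open Finset Literature.Probability.Percolation Literature.Probability.Percolation.DecisionTree
open scoped Classical

namespace TreeCount

variable {ι : Type*} [DecidableEq ι]

/-- A self-determined map takes the same value on `X` and on its swap `X →_{Fm X} Y` (the swap agrees with `X` on
`Fm X`). [cite: Gladkov2024, Lemma 3.1] -/
theorem selfDetermined_apply_splice {Fm : Finset ι → Finset ι} (hF : SelfDetermined Fm) (X Y : Finset ι) :
    Fm (splice (Fm X) X Y) = Fm X :=
  hF X _ fun _ hi => (mem_splice_of_mem hi).symm

/-- The complement of the swap `X →_F (D ∖ X)` inside `D` is the opposite swap `(D ∖ X) →_F X` (for `X ⊆ D`).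
[folklore] -/
theorem sdiff_splice_compl {D F X : Finset ι} (hX : X ⊆ D) :
    D \ splice F X (D \ X) = splice F (D \ X) X := by
  ext i
  have hXD : i ∈ X → i ∈ D := fun h => hX h
  rw [mem_sdiff, mem_splice, mem_splice, mem_sdiff]
  tauto

/-- **The counting-world swap is an involution.**  For a self-determined `Fm` and `X ⊆ D`, with
`Z = X →_{Fm X} (D ∖ X)`: `Z →_{Fm Z} (D ∖ Z) = X`. [cite: Gladkov2024, Lemma 3.1] -/
theorem splice_compl_involutive {D : Finset ι} {Fm : Finset ι → Finset ι} (hF : SelfDetermined Fm)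
    {X : Finset ι} (hX : X ⊆ D) :
    splice (Fm (splice (Fm X) X (D \ X))) (splice (Fm X) X (D \ X)) (D \ splice (Fm X) X (D \ X)) = X := by
  rw [selfDetermined_apply_splice hF, sdiff_splice_compl hX]
  exact splice_splice_left (Fm X) X (D \ X)

/-- The swap `X ↦ X →_{Fm X} (D ∖ X)` maps `𝒫(D)` into `𝒫(D)`. [folklore] -/
theorem splice_compl_subset {D : Finset ι} (Fm : Finset ι → Finset ι) {X : Finset ι} (hX : X ⊆ D) :
    splice (Fm X) X (D \ X) ⊆ D :=
  splice_subset hX sdiff_subset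

/-- **Injectivity (side 0).**  For a self-determined `Fm`, `X ↦ X →_{Fm X} (D ∖ X)` is injective on `𝒫(D)`.
[cite: Gladkov2024, Lemma 3.1] -/
theorem injOn_treeSwap {D : Finset ι} {Fm : Finset ι → Finset ι} (hF : SelfDetermined Fm) :
    Set.InjOn (fun X => splice (Fm X) X (D \ X)) (↑D.powerset : Set (Finset ι)) := by
  intro X hX X' hX' h
  rw [mem_coe, mem_powerset] at hX hX'
  have h1 := splice_compl_involutive (D := D) hF hX
  have h2 := splice_compl_involutive (D := D) hF hX'
  simp only at h
  rw [h] at h1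
  exact h1.symm.trans h2

/-- **Injectivity (side 1).**  For a self-determined `Fm`, the complemented swap `X ↦ (D ∖ X) →_{Fm X} X`
(complement on the revealed set, `X` elsewhere) is injective on `𝒫(D)`. [cite: Gladkov2024, Lemma 3.1] -/
theorem injOn_treeSwap' {D : Finset ι} {Fm : Finset ι → Finset ι} (hF : SelfDetermined Fm) :
    Set.InjOn (fun X => splice (Fm X) (D \ X) X) (↑D.powerset : Set (Finset ι)) := by
  intro X hX X' hX' h
  have hXD : X ⊆ D := by rw [mem_coe, mem_powerset] at hX; exact hX
  have hXD' : X' ⊆ D := by rw [mem_coe, mem_powerset] at hX'; exact hX'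
  refine injOn_treeSwap (D := D) hF hX hX' ?_
  simp only at h ⊢
  have e1 : splice (Fm X) X (D \ X) = D \ splice (Fm X) (D \ X) X := by
    rw [← sdiff_splice_compl hXD, Finset.sdiff_sdiff_eq_self (splice_compl_subset Fm hXD)]
  have e2 : splice (Fm X') X' (D \ X') = D \ splice (Fm X') (D \ X') X' := by
    rw [← sdiff_splice_compl hXD', Finset.sdiff_sdiff_eq_self (splice_compl_subset Fm hXD')]
  rw [e1, e2, h]

/-- **Wins are distinct (side 0).**  For any predicates `TN`, `W` on configurations and any self-determined `Fm`:
the number of `X ⊆ D` in `TN` whose swap `X →_{Fm X} (D∖X)` satisfies `W` is at most the number of `Z ⊆ D`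
satisfying `W`. [this work] -/
theorem card_wins_le (D : Finset ι) {Fm : Finset ι → Finset ι} (hF : SelfDetermined Fm)
    (TN W : Finset ι → Prop) :
    (D.powerset.filter fun X => TN X ∧ W (splice (Fm X) X (D \ X))).card ≤
      (D.powerset.filter fun Z => W Z).card := by
  refine Finset.card_le_card_of_injOn (fun X => splice (Fm X) X (D \ X)) (fun X hX => ?_) fun X hX X' hX' h => ?_
  · rw [mem_coe, mem_filter, mem_powerset] at hX ⊢
    exact ⟨splice_compl_subset Fm hX.1, hX.2.2⟩
  · rw [mem_coe, mem_filter] at hX hX'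
    exact injOn_treeSwap (D := D) hF (mem_coe.2 hX.1) (mem_coe.2 hX'.1) h

/-- **Wins are distinct (side 1)**: the same for the complemented swap `(D∖X) →_{Fm X} X`. [this work] -/
theorem card_wins'_le (D : Finset ι) {Fm : Finset ι → Finset ι} (hF : SelfDetermined Fm)
    (TN W : Finset ι → Prop) :
    (D.powerset.filter fun X => TN X ∧ W (splice (Fm X) (D \ X) X)).card ≤
      (D.powerset.filter fun Z => W Z).card := by
  refine Finset.card_le_card_of_injOn (fun X => splice (Fm X) (D \ X) X) (fun X hX => ?_) fun X hX X' hX' h => ?_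
  · rw [mem_coe, mem_filter, mem_powerset] at hX ⊢
    exact ⟨splice_subset sdiff_subset hX.1, hX.2.2⟩
  · rw [mem_coe, mem_filter] at hX hX'
    exact injOn_treeSwap' (D := D) hF (mem_coe.2 hX.1) (mem_coe.2 hX'.1) h

/-- **The decision-tree criterion (side 0).**  If one self-determined map `Fm` (one decision tree) wins — its swap lands
in `W` — on at least a `1/m` fraction of `TN` (`#TN ≤ m·#wins`), then `#TN ≤ m·#W`. [this work] -/
theorem card_le_mul_of_tree (D : Finset ι) {Fm : Finset ι → Finset ι} (hF : SelfDetermined Fm)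
    (TN W : Finset ι → Prop) (m : ℕ)
    (h : (D.powerset.filter fun X => TN X).card ≤
      m * (D.powerset.filter fun X => TN X ∧ W (splice (Fm X) X (D \ X))).card) :
    (D.powerset.filter fun X => TN X).card ≤ m * (D.powerset.filter fun Z => W Z).card :=
  h.trans (Nat.mul_le_mul_left m (card_wins_le D hF TN W))

/-- **The decision-tree criterion (side 1)**, with the complemented swap. [this work] -/
theorem card_le_mul_of_tree' (D : Finset ι) {Fm : Finset ι → Finset ι} (hF : SelfDetermined Fm)
    (TN W : Finset ι → Prop) (m : ℕ)
    (h : (D.powerset.filter fun X => TN X).card ≤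
      m * (D.powerset.filter fun X => TN X ∧ W (splice (Fm X) (D \ X) X)).card) :
    (D.powerset.filter fun X => TN X).card ≤ m * (D.powerset.filter fun Z => W Z).card :=
  h.trans (Nat.mul_le_mul_left m (card_wins'_le D hF TN W))

/-- **The decision-tree criterion for a finite family (a "randomized tree" with rational weights).**  Given finitely
many self-determined maps `Fm k` with sides `side k` (`false` = swap, `true` = complemented swap), if
`(#family)·#TN ≤ m · Σ_k #wins_k` then `#TN ≤ m·#W` — because each `#wins_k ≤ #W`. [this work] -/
theorem card_le_mul_of_trees (D : Finset ι) {κ : Type*} (K : Finset κ) (hK : K.Nonempty)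
    (Fm : κ → Finset ι → Finset ι) (hF : ∀ k ∈ K, SelfDetermined (Fm k)) (side : κ → Bool)
    (TN W : Finset ι → Prop) (m : ℕ)
    (h : K.card * (D.powerset.filter fun X => TN X).card ≤
      m * ∑ k ∈ K, (D.powerset.filter fun X => TN X ∧
        W (if side k then splice (Fm k X) (D \ X) X else splice (Fm k X) X (D \ X))).card) :
    (D.powerset.filter fun X => TN X).card ≤ m * (D.powerset.filter fun Z => W Z).card := by
  have hwins : ∀ k ∈ K, (D.powerset.filter fun X => TN X ∧
      W (if side k then splice (Fm k X) (D \ X) X else splice (Fm k X) X (D \ X))).card ≤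
        (D.powerset.filter fun Z => W Z).card := by
    intro k hk
    cases side k
    · simp only [Bool.false_eq_true, ↓reduceIte]
      exact card_wins_le D (hF k hk) TN W
    · simp only [↓reduceIte]
      exact card_wins'_le D (hF k hk) TN W
  have hsum : ∑ k ∈ K, (D.powerset.filter fun X => TN X ∧
      W (if side k then splice (Fm k X) (D \ X) X else splice (Fm k X) X (D \ X))).card ≤
        K.card * (D.powerset.filter fun Z => W Z).card := by
    calc _ ≤ ∑ k ∈ K, (D.powerset.filter fun Z => W Z).card := Finset.sum_le_sum hwins
      _ = K.card * (D.powerset.filter fun Z => W Z).card := by rw [Finset.sum_const, smul_eq_mul]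
  have h2 : K.card * (D.powerset.filter fun X => TN X).card ≤
      K.card * (m * (D.powerset.filter fun Z => W Z).card) := by
    calc _ ≤ m * (K.card * (D.powerset.filter fun Z => W Z).card) := h.trans (Nat.mul_le_mul_left m hsum)
      _ = K.card * (m * (D.powerset.filter fun Z => W Z).card) := by ring
  exact Nat.le_of_mul_le_mul_left h2 (Finset.card_pos.2 hK)

end TreeCount

/-! ### Plugging the criterion into the product row -/

namespace ThreeClusterSwap

variable {V : Type*} [Fintype V] [DecidableEq V]

/-- **Product row from one good tree per class.**  If in every class `I ⊆ U` (free edges `F = U ∖ I`, first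
configuration `I ∪ T`, second `I ∪ (F ∖ T)`) there is a self-determined map `Fm` on configurations (a decision tree
reading the first configuration) and a side such that three times the number of TN-configurations `T` of the class whose
swap `T →_{Fm T} (F ∖ T)` (side `false`) resp. `(F ∖ T) →_{Fm T} T` (side `true`), read as a first configuration, lies in
`ab|c ∪ ac|b`, is at least the number of TN-configurations of the class, then
`P(abc)·P(a|b|c) ≤ 3·(P(ab|c) + P(ac|b))` on every finite weighted graph — the per-apex hypothesis shape of ✓ p560550.
By ✓ p583525 `productRow_of_classCount` and `TreeCount.card_le_mul_of_tree[']`. [this work] -/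
theorem productRow_of_treeWins (w : Sym2 V → unitInterval) (a b c : V)
    (h : ∀ I U : Finset (Sym2 V), I ⊆ U → ∃ (Fm : Finset (Sym2 V) → Finset (Sym2 V)) (side : Bool),
      SelfDetermined Fm ∧
      (((U \ I).powerset).filter fun T =>
          (¬ (openGraph (↑(I ∪ ((U \ I) \ T)) : Set (Sym2 V))).Reachable a b ∧
            ¬ (openGraph (↑(I ∪ ((U \ I) \ T)) : Set (Sym2 V))).Reachable a c ∧
            ¬ (openGraph (↑(I ∪ ((U \ I) \ T)) : Set (Sym2 V))).Reachable b c) ∧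
          ((openGraph (↑(I ∪ T) : Set (Sym2 V))).Reachable a b ∧
            (openGraph (↑(I ∪ T) : Set (Sym2 V))).Reachable a c)).card ≤
        3 * (((U \ I).powerset).filter fun T =>
          ((¬ (openGraph (↑(I ∪ ((U \ I) \ T)) : Set (Sym2 V))).Reachable a b ∧
            ¬ (openGraph (↑(I ∪ ((U \ I) \ T)) : Set (Sym2 V))).Reachable a c ∧
            ¬ (openGraph (↑(I ∪ ((U \ I) \ T)) : Set (Sym2 V))).Reachable b c) ∧
          ((openGraph (↑(I ∪ T) : Set (Sym2 V))).Reachable a b ∧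
            (openGraph (↑(I ∪ T) : Set (Sym2 V))).Reachable a c)) ∧
          (let Z := if side then splice (Fm T) ((U \ I) \ T) T else splice (Fm T) T ((U \ I) \ T)
           ((openGraph (↑(I ∪ Z) : Set (Sym2 V))).Reachable a b ∧
              ¬ (openGraph (↑(I ∪ Z) : Set (Sym2 V))).Reachable a c) ∨
            ((openGraph (↑(I ∪ Z) : Set (Sym2 V))).Reachable a c ∧
              ¬ (openGraph (↑(I ∪ Z) : Set (Sym2 V))).Reachable a b))).card) :
    (Literature.Probability.LatticeModels.prodBernoulli w).real (openConn a b ∩ openConn a c) *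
      (Literature.Probability.LatticeModels.prodBernoulli w).real
        ((openConn a b)ᶜ ∩ (openConn a c)ᶜ ∩ (openConn b c)ᶜ) ≤
    3 * ((Literature.Probability.LatticeModels.prodBernoulli w).real (openConn a b ∩ (openConn a c)ᶜ) +
      (Literature.Probability.LatticeModels.prodBernoulli w).real (openConn a c ∩ (openConn a b)ᶜ)) := by
  refine productRow_of_classCount w a b c (m := 3) (by norm_num) fun I U hIU => ?_
  obtain ⟨Fm, side, hF, hcount⟩ := h I U hIU
  set D : Finset (Sym2 V) := U \ I with hD
  let R : Finset (Sym2 V) → V → V → Prop := fun S x y => (openGraph (↑S : Set (Sym2 V))).Reachable x y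
  let TN : Finset (Sym2 V) → Prop := fun T =>
    (¬ R (I ∪ (D \ T)) a b ∧ ¬ R (I ∪ (D \ T)) a c ∧ ¬ R (I ∪ (D \ T)) b c) ∧ (R (I ∪ T) a b ∧ R (I ∪ T) a c)
  let W : Finset (Sym2 V) → Prop := fun Z => (R (I ∪ Z) a b ∧ ¬ R (I ∪ Z) a c) ∨ (R (I ∪ Z) a c ∧ ¬ R (I ∪ Z) a b)
  have key : (D.powerset.filter fun T => TN T).card ≤ 3 * (D.powerset.filter fun Z => W Z).card := by
    cases side
    · simp only [Bool.false_eq_true, ↓reduceIte] at hcount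
      have k0 := TreeCount.card_le_mul_of_tree D hF TN W 3 (by convert hcount using 5)
      convert k0 using 5
    · simp only [↓reduceIte] at hcount
      have k1 := TreeCount.card_le_mul_of_tree' D hF TN W 3 (by convert hcount using 5)
      convert k1 using 5
  have e : ((D.powerset.filter fun T => TN T).card : ℝ) ≤ 3 * ((D.powerset.filter fun Z => W Z).card : ℝ) := by
    exact_mod_cast key
  exact e

end ThreeClusterSwap

end Summit.CriticalPhenomena.PercolationContinuityZ3.Theorems
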